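import Summits.AtomisticToContinuum.HydrodynamicLimit.Theses.OneFlightGossipEngine
import Summits.AtomisticToContinuum.HydrodynamicLimit.Theorems.TransferActivityTails.Negative.EquilibriumReduction

/-!
# Sketch — crux-ideate stmt-AtomisticToContinuum-17703 (`EnergyActivityTails`), round 1, ideator 2

First lemmas of the two idea cards `cool-gains-ride-impulse` and `hot-sojourn-gossip-halving`.
Nothing here asserts a Theses declaration; §1 is PROVED kinematics, §2 is proved domination, §3 typed targets (Props),
§4 the energy gossip identity (PROVED) and the abstract halving-supermartingale tail (typed).

* §0 read-back: the crux is `TailsOf energyOf` (`Iff.rfl`).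
* §1 ONE-SIDED collision kinematics (card 1's lever, proved): for the elastic reflection `reflectVel n (v, w)`,
  GAIN of the first particle `≤ ‖w‖ · ‖Δv‖` (donor speed × impulse) and LOSS `≤ ‖v‖ · ‖Δv‖` (own speed × impulse).
* §2 the hot-donor gain summand `hotDonorGainOf W₀`, the tail statement `HotDonorGainTails W₀ := TailsOf (hotDonorGainOf W₀)`,
  and `EAT → HotDonorGainTails W₀` (domination, proved from the landed `tailsOf_of_le`).
* §3 the typed targets of card 1: `EnergyTelescoping` (trajectory plumbing) and the transfer
  `CoolGainsRideImpulse : CAT → (∃ W₀ > 0, HotDonorGainTails W₀) → EAT`.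
* §4 card 2: `EnergyGossipIdentity` (zero-mean unit kick ⇒ mean post-collisional energy = pair average) — PROVED
  (`energyGossipIdentity_proof`); `HalvingSupermartingaleTail` (typed, Mathlib `Filtration`/`condExp`).
-/

noncomputable section

open MeasureTheory
open scoped InnerProductSpace ENNReal

namespace Summit.AtomisticToContinuum.HydrodynamicLimit.Cruxes.EnergyActivityTails.IdeatorTwo

open Literature.MathematicalPhysics.KineticTheory Literature.Analysis.FluidPDE
open Summit.AtomisticToContinuum.HydrodynamicLimit.Theorems.TransferActivityTailsNegative

/-! ## §0 Read-back -/

example : Summit.AtomisticToContinuum.HydrodynamicLimit.Theses.OneFlightGossipEngine.EnergyActivityTails ↔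
    TailsOf energyOf := Iff.rfl

example : Summit.AtomisticToContinuum.HydrodynamicLimit.Theses.OneFlightGossipEngine.CollisionActivityTails ↔
    TailsOf momentumOf := Iff.rfl

/-! ## §1 One-sided kinematics of the elastic reflection (card `cool-gains-ride-impulse`, PROVED) -/

/-- Energy jump of the first particle, GAIN form: `‖v'‖² − ‖v‖² = −a²‖n‖² − 2a⟪w, n⟫`, `a = ⟪v − w, n⟫/‖n‖²`. -/
theorem energy_jump_eq_gainForm (n : V3) (p : V3 × V3) :
    ‖(reflectVel n p).1‖ ^ 2 - ‖p.1‖ ^ 2 =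
      -((⟪p.1 - p.2, n⟫_ℝ / ‖n‖ ^ 2) ^ 2 * ‖n‖ ^ 2) - 2 * (⟪p.1 - p.2, n⟫_ℝ / ‖n‖ ^ 2) * ⟪p.2, n⟫_ℝ := by
  by_cases hn : n = 0
  · subst hn; simp [reflectVel]
  have hn2 : ‖n‖ ^ 2 ≠ 0 := by positivity
  simp only [reflectVel]
  rw [norm_sub_sq_real, real_inner_smul_right, norm_smul, mul_pow, Real.norm_eq_abs, sq_abs, inner_sub_left]
  field_simp
  ring

/-- Energy jump of the first particle, LOSS form: `‖v'‖² − ‖v‖² = a²‖n‖² − 2a⟪v, n⟫`. -/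
theorem energy_jump_eq_lossForm (n : V3) (p : V3 × V3) :
    ‖(reflectVel n p).1‖ ^ 2 - ‖p.1‖ ^ 2 =
      (⟪p.1 - p.2, n⟫_ℝ / ‖n‖ ^ 2) ^ 2 * ‖n‖ ^ 2 - 2 * (⟪p.1 - p.2, n⟫_ℝ / ‖n‖ ^ 2) * ⟪p.1, n⟫_ℝ := by
  by_cases hn : n = 0
  · subst hn; simp [reflectVel]
  have hn2 : ‖n‖ ^ 2 ≠ 0 := by positivity
  simp only [reflectVel]
  rw [norm_sub_sq_real, real_inner_smul_right, norm_smul, mul_pow, Real.norm_eq_abs, sq_abs]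
  field_simp
  ring

/-- The impulse of the first particle: `‖v' − v‖ = |a| ‖n‖`. -/
theorem impulse_eq (n : V3) (p : V3 × V3) :
    ‖(reflectVel n p).1 - p.1‖ = |⟪p.1 - p.2, n⟫_ℝ / ‖n‖ ^ 2| * ‖n‖ := by
  simp only [reflectVel, sub_sub_cancel_left, norm_neg, norm_smul, Real.norm_eq_abs]

/-- **GAIN ≤ DONOR SPEED × IMPULSE.** In an elastic reflection of the velocity pair `(v, w)` along any direction `n`,
the energy gained by the first particle is at most the partner's speed times the first particle's impulse:
`(‖v'‖² − ‖v‖²)/2 ≤ ‖w‖ · ‖v' − v‖`. No sign / contact condition is needed. -/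
theorem energyGain_le_donorSpeed_mul_impulse (n : V3) (p : V3 × V3) :
    (‖(reflectVel n p).1‖ ^ 2 - ‖p.1‖ ^ 2) / 2 ≤ ‖p.2‖ * ‖(reflectVel n p).1 - p.1‖ := by
  rw [energy_jump_eq_gainForm, impulse_eq]
  set a : ℝ := ⟪p.1 - p.2, n⟫_ℝ / ‖n‖ ^ 2 with ha
  have hx : -(2 * a * ⟪p.2, n⟫_ℝ) ≤ 2 * (|a| * (‖p.2‖ * ‖n‖)) :=
    calc -(2 * a * ⟪p.2, n⟫_ℝ) ≤ |2 * a * ⟪p.2, n⟫_ℝ| := neg_le_abs _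
      _ = 2 * (|a| * |⟪p.2, n⟫_ℝ|) := by rw [abs_mul, abs_mul, abs_two, mul_assoc]
      _ ≤ 2 * (|a| * (‖p.2‖ * ‖n‖)) := by gcongr; exact abs_real_inner_le_norm p.2 n
  have h2 : 0 ≤ a ^ 2 * ‖n‖ ^ 2 := by positivity
  have key : (-(a ^ 2 * ‖n‖ ^ 2) - 2 * a * ⟪p.2, n⟫_ℝ) / 2 ≤ |a| * (‖p.2‖ * ‖n‖) := by linarith
  calc (-(a ^ 2 * ‖n‖ ^ 2) - 2 * a * ⟪p.2, n⟫_ℝ) / 2 ≤ |a| * (‖p.2‖ * ‖n‖) := key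
    _ = ‖p.2‖ * (|a| * ‖n‖) := by ring

/-- **LOSS ≤ OWN SPEED × IMPULSE.** `(‖v‖² − ‖v'‖²)/2 ≤ ‖v‖ · ‖v' − v‖`. -/
theorem energyLoss_le_ownSpeed_mul_impulse (n : V3) (p : V3 × V3) :
    (‖p.1‖ ^ 2 - ‖(reflectVel n p).1‖ ^ 2) / 2 ≤ ‖p.1‖ * ‖(reflectVel n p).1 - p.1‖ := by
  have h := energy_jump_eq_lossForm n p
  rw [impulse_eq]
  set a : ℝ := ⟪p.1 - p.2, n⟫_ℝ / ‖n‖ ^ 2 with ha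
  have hx : 2 * a * ⟪p.1, n⟫_ℝ ≤ 2 * (|a| * (‖p.1‖ * ‖n‖)) :=
    calc 2 * a * ⟪p.1, n⟫_ℝ ≤ |2 * a * ⟪p.1, n⟫_ℝ| := le_abs_self _
      _ = 2 * (|a| * |⟪p.1, n⟫_ℝ|) := by rw [abs_mul, abs_mul, abs_two, mul_assoc]
      _ ≤ 2 * (|a| * (‖p.1‖ * ‖n‖)) := by gcongr; exact abs_real_inner_le_norm p.1 n
  have h2 : 0 ≤ a ^ 2 * ‖n‖ ^ 2 := by positivity
  have key : (‖p.1‖ ^ 2 - ‖(reflectVel n p).1‖ ^ 2) / 2 ≤ |a| * (‖p.1‖ * ‖n‖) := by linarith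
  calc (‖p.1‖ ^ 2 - ‖(reflectVel n p).1‖ ^ 2) / 2 ≤ |a| * (‖p.1‖ * ‖n‖) := key
    _ = ‖p.1‖ * (|a| * ‖n‖) := by ring

/-- **Cool donors hand over at most `W₀ ×` impulse.** If the partner is no faster than `W₀`, the first particle's energy
gain is at most `W₀ · ‖Δv‖` — the record-level inequality behind `a^e ≤ 2W₀·a^m + 2·(hot-donor gains) + endpoint`. -/
theorem energyGain_le_of_donorSpeed_le {W₀ : ℝ} (n : V3) (p : V3 × V3) (hW : ‖p.2‖ ≤ W₀) :
    (‖(reflectVel n p).1‖ ^ 2 - ‖p.1‖ ^ 2) / 2 ≤ W₀ * ‖(reflectVel n p).1 - p.1‖ :=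
  (energyGain_le_donorSpeed_mul_impulse n p).trans (mul_le_mul_of_nonneg_right hW (norm_nonneg _))

/-- The gain is also at most the donor's kinetic energy: `(‖v'‖² − ‖v‖²)/2 ≤ ‖w‖²/2` (pair energy conservation would give
it at once for contact records; here directly from the gain form: `−a²‖n‖² − 2a⟪w,n⟫ ≤ ⟪w,n⟫²/‖n‖² ≤ ‖w‖²`). -/
theorem energyGain_le_donorEnergy (n : V3) (p : V3 × V3) :
    (‖(reflectVel n p).1‖ ^ 2 - ‖p.1‖ ^ 2) / 2 ≤ ‖p.2‖ ^ 2 / 2 := by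
  by_cases hn : n = 0
  · subst hn; simp [reflectVel]; positivity
  rw [energy_jump_eq_gainForm]
  set a : ℝ := ⟪p.1 - p.2, n⟫_ℝ / ‖n‖ ^ 2 with ha
  have hn' : 0 < ‖n‖ := norm_pos_iff.2 hn
  have hcs : |⟪p.2, n⟫_ℝ| ≤ ‖p.2‖ * ‖n‖ := abs_real_inner_le_norm p.2 n
  have hsq : ⟪p.2, n⟫_ℝ ^ 2 ≤ ‖p.2‖ ^ 2 * ‖n‖ ^ 2 := by
    calc ⟪p.2, n⟫_ℝ ^ 2 = |⟪p.2, n⟫_ℝ| ^ 2 := (sq_abs _).symm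
      _ ≤ (‖p.2‖ * ‖n‖) ^ 2 := by gcongr
      _ = ‖p.2‖ ^ 2 * ‖n‖ ^ 2 := by ring
  -- `−a²‖n‖² − 2a⟪w,n⟫ = ‖n‖⁻²(⟪w,n⟫² − (a‖n‖² + ⟪w,n⟫)²) ≤ ⟪w,n⟫²/‖n‖² ≤ ‖w‖²`
  have hnn : 0 < ‖n‖ ^ 2 := by positivity
  have key : -(a ^ 2 * ‖n‖ ^ 2) - 2 * a * ⟪p.2, n⟫_ℝ ≤ ‖p.2‖ ^ 2 := by
    have h1 : -(a ^ 2 * ‖n‖ ^ 2) - 2 * a * ⟪p.2, n⟫_ℝ ≤ ⟪p.2, n⟫_ℝ ^ 2 / ‖n‖ ^ 2 := by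
      rw [le_div_iff₀ hnn]
      nlinarith [sq_nonneg (a * ‖n‖ ^ 2 + ⟪p.2, n⟫_ℝ)]
    have h2 : ⟪p.2, n⟫_ℝ ^ 2 / ‖n‖ ^ 2 ≤ ‖p.2‖ ^ 2 := by
      rw [div_le_iff₀ hnn]; exact hsq
    exact h1.trans h2
  linarith

/-! ## §2 The hot-donor gain summand and its tail statement (card `cool-gains-ride-impulse`) -/

/-- Energy RECEIVED by `i` in the ordered record `c` FROM A DONOR FASTER THAN `W₀`: the positive part of the first partner's
energy jump, kept only when the second partner's pre-collisional speed exceeds `W₀`. -/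
def hotDonorGainOf (W₀ : ℝ) (N : ℕ) (i : Fin (N + 1)) (c : Rec N) : ℝ :=
  if c.fst = i then (if W₀ < ‖c.preVel.2‖ then max 0 ((‖c.postVel.1‖ ^ 2 - ‖c.preVel.1‖ ^ 2) / 2) else 0) else 0

/-- **HDGT(W₀) — hot-donor gain tails**: the crux's frame (`TailsOf`, verbatim quantifiers `∃V₀ ∀V ∀ε ∃τ₀ ∀τ ∃N₀ ∀N ∀s`) for the
window functional `(σ/τ) Σ_{collisions of i in (s,s+w], donor speed > W₀} (ΔE_i)₊` under the TRUE pre-shock law. -/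
def HotDonorGainTails (W₀ : ℝ) : Prop := TailsOf (hotDonorGainOf W₀)

theorem hotDonorGainOf_nonneg (W₀ : ℝ) (N : ℕ) (i : Fin (N + 1)) (c : Rec N) : 0 ≤ hotDonorGainOf W₀ N i c := by
  unfold hotDonorGainOf; split_ifs <;> first | exact le_max_left _ _ | exact le_rfl

theorem hotDonorGainOf_le_energyOf (W₀ : ℝ) (N : ℕ) (i : Fin (N + 1)) (c : Rec N) :
    hotDonorGainOf W₀ N i c ≤ energyOf N i c := by
  unfold hotDonorGainOf energyOf
  split_ifs with h1 h2
  · refine max_le (by positivity) ?_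
    exact div_le_div_of_nonneg_right (le_abs_self _) (by norm_num)
  · positivity
  · exact le_rfl

/-- **The crux implies HDGT(W₀) for every `W₀`** (record-by-record domination, landed `tailsOf_of_le`). -/
theorem hotDonorGainTails_of_energyActivityTails
    (h : Summit.AtomisticToContinuum.HydrodynamicLimit.Theses.OneFlightGossipEngine.EnergyActivityTails) (W₀ : ℝ) :
    HotDonorGainTails W₀ :=
  tailsOf_of_le (hotDonorGainOf_nonneg W₀) (hotDonorGainOf_le_energyOf W₀) h

/-! ## §3 Typed targets of card `cool-gains-ride-impulse` (statements only) -/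

/-- **Energy telescoping along the orbit** (trajectory plumbing; the energy analogue of the census ledger stub A of line
`level-census-comparison`): on the good set, the window sum of the first partner's energy jumps over the records of `i` is the
change of `i`'s kinetic energy across the window (post-collisional sampling, binary collisions). -/
def EnergyTelescoping : Prop :=
  ∀ (σ : ℝ) (N : ℕ) (Φ : Flow σ N) (z : Config (N + 1) (Fin 3) T3), z ∈ Φ.good →
    ∀ (i : Fin (N + 1)) (s s' : ℝ), 0 ≤ s → s ≤ s' →
      Φ.collisionSum (Set.Ioc s s') (fun c => if c.fst = i then ‖c.postVel.1‖ ^ 2 - ‖c.preVel.1‖ ^ 2 else 0) z =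
        ‖(Φ.flow s' z i).2‖ ^ 2 - ‖(Φ.flow s z i).2‖ ^ 2

/-- **Card 1's transfer, typed**: `CAT ∧ HDGT(W₀)` (one `W₀ > 0`) `⟹ EAT`.  Proof plan (crux-plan seat): pathwise on the good set
`a^e_i = (σ/τ)(U_i + D_i)`, `U_i − D_i = E_i(s+w) − E_i(s)` (`EnergyTelescoping`), `U_i ≤ W₀ Σ‖Δv_i‖ + G^{hot}_i`
(`energyGain_le_of_donorSpeed_le` on contact records, `ofConfig_preVel`/`reflectVel_reflectVel`), hence
`a^e_i ≤ 2W₀ a^m_i + 2 g_i + (σ/τ)‖v_i(s)‖²/2`; then `x𝟙{x>V} ≤ 3Σ pieces`, CAT at threshold `V/(6W₀)`, HDGT at `V/6`, and the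
endpoint term in MEAN by `configEnergy_flow` + `stub_meanEnergyBound` (`≤ 3(σ/τ)e₀ → 0`). -/
def CoolGainsRideImpulse : Prop :=
  Summit.AtomisticToContinuum.HydrodynamicLimit.Theses.OneFlightGossipEngine.CollisionActivityTails →
    (∃ W₀ : ℝ, 0 < W₀ ∧ HotDonorGainTails W₀) →
      Summit.AtomisticToContinuum.HydrodynamicLimit.Theses.OneFlightGossipEngine.EnergyActivityTails

/-! ## §4 First lemmas of card `hot-sojourn-gossip-halving` (identity PROVED, engine typed) -/

/-- **Energy gossip identity** (the trace companion of the PROVED support `GossipStressIdentity` / `KacPairHeatFlux`): for a kick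
law `ν` on the unit sphere with zero mean, the post-collisional velocity `x′ = ½(x+y) + ½‖x−y‖ω` has MEAN kinetic energy equal to
the pair average: `∫ ‖x′‖² dν = (‖x‖² + ‖y‖²)/2`.  Hence, given the coarse past, a sphere hotter than its partner loses HALF the
energy difference in conditional mean — the supermartingale behind the hot-sojourn halving. -/
def EnergyGossipIdentity : Prop :=
  ∀ ν : Measure V3, IsProbabilityMeasure ν → (∀ᵐ ω ∂ν, ‖ω‖ = 1) → ∫ ω, ω ∂ν = 0 →
    ∀ x y : V3, ∫ ω, ‖(1 / 2 : ℝ) • (x + y) + (‖x - y‖ / 2) • ω‖ ^ 2 ∂ν = (‖x‖ ^ 2 + ‖y‖ ^ 2) / 2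

/-- `EnergyGossipIdentity` holds (parallelogram law + `integral_inner`; only `∫ω = 0` and `‖ω‖ = 1` a.e. are used). -/
theorem energyGossipIdentity_proof : EnergyGossipIdentity := by
  intro ν hν hunit hmean x y
  set V : V3 := (1 / 2 : ℝ) • (x + y) with hV
  set h : ℝ := ‖x - y‖ / 2 with hh
  have hint : Integrable (fun ω : V3 => ω) ν :=
    Integrable.of_bound aestronglyMeasurable_id 1 (by filter_upwards [hunit] with ω hω; simp [hω])
  have hpt : (fun ω => ‖V + h • ω‖ ^ 2) =ᵐ[ν] fun ω => (‖V‖ ^ 2 + h ^ 2) + (2 * h) * ⟪V, ω⟫_ℝ := by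
    filter_upwards [hunit] with ω hω
    rw [norm_add_sq_real, real_inner_smul_right, norm_smul h ω, Real.norm_eq_abs, hω, mul_one, sq_abs]
    ring
  have hlin : Integrable (fun ω => (2 * h) * ⟪V, ω⟫_ℝ) ν := (hint.const_inner V).const_mul (2 * h)
  rw [integral_congr_ae hpt, integral_add (integrable_const _) hlin, integral_const, integral_const_mul,
    integral_inner hint V, hmean, inner_zero_right, mul_zero, add_zero]
  simp only [probReal_univ, one_smul]
  simp only [hV, hh]
  rw [norm_smul, Real.norm_eq_abs, abs_of_pos (by norm_num : (0 : ℝ) < 1 / 2)]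
  have e1 := norm_add_sq_real x y
  have e2 := norm_sub_sq_real x y
  linear_combination (1 / 4 : ℝ) * e1 + (1 / 4 : ℝ) * e2

/-- **Halving supermartingale ⇒ geometric tail** (abstract engine of card `hot-sojourn-gossip-halving`, measure theory only): a
nonnegative adapted integrable sequence whose conditional mean at least HALVES at each step satisfies
`P(Z_k > z) ≤ 2^{-k} E[Z_0]/z` (iterated conditional expectation + Markov).  Instantiated with `Z_k` = the excess of a tagged donor's
kinetic energy over `W₀²/4` after its `k`-th collision with a partner slower than `W₀/√2` (halving = `EnergyGossipIdentity` under
per-flight kick chaos), it says hot sojourns are geometrically short. -/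
def HalvingSupermartingaleTail : Prop :=
  ∀ (Ω : Type) (mΩ : MeasurableSpace Ω) (μ : Measure Ω) [IsProbabilityMeasure μ] (ℱ : Filtration ℕ mΩ) (Z : ℕ → Ω → ℝ),
    Adapted ℱ Z → (∀ k, 0 ≤ᵐ[μ] Z k) → (∀ k, Integrable (Z k) μ) →
    (∀ k, μ[Z (k + 1)|ℱ k] ≤ᵐ[μ] fun ω => Z k ω / 2) →
    ∀ (k : ℕ) (z : ℝ), 0 < z → μ {ω | z < Z k ω} ≤ ENNReal.ofReal ((2⁻¹ : ℝ) ^ k * (∫ ω, Z 0 ω ∂μ) / z)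

end Summit.AtomisticToContinuum.HydrodynamicLimit.Cruxes.EnergyActivityTails.IdeatorTwo
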